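import Mathlib

/-!
# Zhang (2022): the exponent layer with the (7.5)-row parametrised by a mean-square exponent

Trunk T-ANT (NumberTheory/LFunctions). Y. Zhang, *Discrete mean estimates and the Landau–Siegel
zero*, arXiv:2211.02515v1 (2022) [Zhang2022LandauSiegel], §3, (7.5) [p. 13], (14.3) [p. 28].
**Status of the source: an unrefereed manuscript, a claimed result under adjudication** (audit +
repair census of arXiv:2211.02515; no claim about Landau–Siegel is made here).

Companion of `Zhang2022.ExponentLayer` for the cell's ALT seat 3 (structural alternatives,
`HOME/ALT-3.md` §B3). In the proof of (7.5) the manuscript bounds the exceptional characters by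
Hölder with exponents `(2,4,4)` and the large sieve, using the pointwise majorant
`(κ∗a₁)(m) = O(τ₅(m))`, so that `∑_{m<P²} τ₅(m)²/m ≍ (log P²)^{25} = 𝓛^{25·9}`; the resulting row is
`E > 3·68 + (2·25 + 4 + 3)·9 = 717` (`ExponentLayer.AdmissibleA`, fourth conjunct). This file
replaces the constant `25` by a parameter `k` — the exponent of `log P²` in a bound
`∑_{m<P²} |(κ∗a₁)(m)|²/m ≪ (log P²)^k` — and PROVES the elementary linear arithmetic:

* regime (a) (secondary exponents printed): admissible iff `A > 1550 + 18k` for `k ≤ 26`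
  (`admissibleAK_iff`); `k = 25` is `ExponentLayer.AdmissibleA` verbatim (`admissibleAK_25_iff`)
  and gives `A > 2000`; `k = 9` gives `A > 1712` (`admissibleAK9_iff`, witness `A = 1713, E = 430`);
* regime (a2) (thresholds of (3.4)–(3.6) and the `F`-bound free as in
  `ExponentLayer.AdmissibleThresholds`): `A > 26741/20 + (189/10)k` (`lt_of_admissibleThresholdsK`,
  same Farkas multipliers `1/10, 2, 21/20, 1/20, 1`); `k = 25` gives `36191/20 = 1809.55`,
  `k = 9` gives `30143/20 = 1507.15` (witness at `A = 1508`).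

The value `k = 9` is ALT-3's ANALYTIC CLAIM, not proved here: `κ` is multiplicative with
`κ(p) = p^{-β₁} + p^{-β₂} + p^{-β₃} − 1`, `β_j = ijα(1 + O(α𝓛))` purely imaginary, `α = π/log P`
((2.10), (2.13)), so `|κ(p)| → 2` as `α log p → 0` and, by the Euler-product majorant for
non-negative multiplicative functions (`∑_{n≤x} f(n)/n ≤ ∏_{p≤x} ∑_ν f(p^ν)/p^ν`, Hall–Tenenbaum,
*Divisors* (1988), (0.4)) applied to `f = (|κ|∗1)²`,
`∑_{m<P²} |(κ∗a₁)(m)|²/m ≤ ‖a₁‖_∞² · C · (log P²)^9` with `C` absolute, against `(log P²)^{25}`.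
Whether that claim is right is for the cell's referees; this file only certifies what the exponent
`k` does to the linear system. None of this bears on the cell's verdict: the closing rows contain
no exponent of this layer (`Section2AllIota.not_mainOrderContradictionG_all` holds for every `A`).
No statement about Theorems 1–2 of the source is made or implied.
-/

namespace Literature.NumberTheory.LFunctions.Zhang2022.ExponentLayerMV

/- Self-contained on purpose (only `Mathlib` is imported): at `k = 25` the two systems below are,
conjunct by conjunct, `Zhang2022.ExponentLayer.AdmissibleA` / `AdmissibleThresholds` (p185287);
`admissibleAK_25_iff` / `admissibleThresholdsK_25_iff` state this against the unfolded printed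
numerals so that the file elaborates independently of that module's build state. -/

/-! ### Regime (a): secondary exponents printed, `A`, `E` free, (7.5)-row with parameter `k` -/

/-- The `A`-dependent rows of the exponent layer with the (7.5)/(14.3)-row written for a general
mean-square exponent `k` of the `m`-sum coefficients: `E > 3·68 + (2k + 4 + 3)·9`
(`k = 25`: the printed `τ₅²` majorant). [cite: Zhang2022LandauSiegel, §3 and (7.5)] -/
def AdmissibleAK (k A E : ℝ) : Prop :=
  E ≤ 2 * 1171 - 1602 ∧                 -- (3.4)
  E ≤ A - 2 - 4 * 9 - 68 - 2 * 585 ∧    -- (3.5) via Lemma 3.1, α* = 𝓛^{-(A+2)}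
  E ≤ A - 17 - 2 * 633 ∧                -- (3.6) via Lemma 3.2
  (3 * 68 + (2 * k + 7) * 9 : ℝ) < E     -- (7.5)/(14.3) with (log P²)^k in place of (log P²)^25

/-- `k = 25` is the printed system (`ExponentLayer.AdmissibleA` unfolded: `E ≤ 740`,
`E ≤ A − 1276`, `E ≤ A − 1283`, `717 < E`). [folklore] -/
theorem admissibleAK_25_iff (A E : ℝ) :
    AdmissibleAK 25 A E ↔ (E ≤ 740 ∧ E ≤ A - 1276 ∧ E ≤ A - 1283 ∧ 717 < E) := by
  simp only [AdmissibleAK]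
  constructor
  · rintro ⟨h₁, h₂, h₃, h₄⟩
    exact ⟨by linarith, by linarith, by linarith, by linarith⟩
  · rintro ⟨h₁, h₂, h₃, h₄⟩
    exact ⟨by linarith, by linarith, by linarith, by linarith⟩

/-- Farkas certificate: rows (3.6) and (7.5) with multipliers `1, 1` give `A > 1550 + 18k`.
[folklore] -/
theorem lt_of_admissibleAK {k A E : ℝ} (h : AdmissibleAK k A E) : 1550 + 18 * k < A := by
  obtain ⟨-, -, h₃, h₄⟩ := h
  linarith

/-- Regime (a) exactly, for `k ≤ 26` (so that the (3.4)-row `E ≤ 740` is not binding):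
admissible iff `A > 1550 + 18k`, witness `E = min 740 (A − 1283)`. [folklore] -/
theorem admissibleAK_iff {k : ℝ} (hk : k ≤ 26) (A : ℝ) :
    (∃ E, AdmissibleAK k A E) ↔ 1550 + 18 * k < A := by
  constructor
  · rintro ⟨E, h⟩
    exact lt_of_admissibleAK h
  · intro hA
    refine ⟨min 740 (A - 1283), ?_, ?_, ?_, ?_⟩
    · exact (min_le_left _ _).trans (by norm_num)
    · exact (min_le_right _ _).trans (by linarith)
    · exact (min_le_right _ _).trans (by linarith)
    · exact lt_min (by linarith) (by linarith)

/-- ALT-3's value `k = 9`: regime (a) admissible iff `A > 1712` (printed: `A > 2000`). [folklore] -/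
theorem admissibleAK9_iff (A : ℝ) : (∃ E, AdmissibleAK 9 A E) ↔ 1712 < A := by
  rw [admissibleAK_iff (by norm_num : (9 : ℝ) ≤ 26)]
  constructor <;> intro h <;> linarith

/-- The smallest admissible integer at `k = 9`: `A = 1713` with `E = 430`. [folklore] -/
theorem admissibleAK9_1713 : AdmissibleAK 9 1713 430 := by
  norm_num [AdmissibleAK]

/-- … and `A = 1712` is not admissible at `k = 9` for any `E`. [folklore] -/
theorem not_admissibleAK9_1712 (E : ℝ) : ¬ AdmissibleAK 9 1712 E := fun h => by
  have := lt_of_admissibleAK h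
  norm_num at this

/-! ### Regime (a2): thresholds of (3.4)–(3.6), the `F`-bound and `E` free, parameter `k` -/

/-- `ExponentLayer.AdmissibleThresholds` with the (7.5)/(14.3)-row written for a general
mean-square exponent `k`. [cite: Zhang2022LandauSiegel, Lemmas 3.4–3.6, 4.1, 4.2, (4.10), (7.5)] -/
def AdmissibleThresholdsK (k A E h₄ h₅ h₆ g : ℝ) : Prop :=
  405 + 1 + h₄ ≤ 20 * g ∧               -- Lemma 4.1
  (405 + 1 : ℝ) < h₆ ∧                  -- Lemma 4.2
  (9 : ℝ) < h₅ - 405 - 1 - g ∧          -- (4.10)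
  (3 * 68 + (2 * k + 7) * 9 : ℝ) < E ∧   -- (7.5)/(14.3)
  E ≤ 2 * h₄ - 1602 ∧                   -- (3.4)
  E ≤ A - 2 - 4 * 9 - 68 - 2 * h₅ ∧     -- (3.5)
  E ≤ A - 17 - 2 * h₆                   -- (3.6)

/-- `k = 25` is the printed system (`ExponentLayer.AdmissibleThresholds` unfolded; the
(7.5)-conjunct reads `717 < E`). [folklore] -/
theorem admissibleThresholdsK_25_iff (A E h₄ h₅ h₆ g : ℝ) :
    AdmissibleThresholdsK 25 A E h₄ h₅ h₆ g ↔
      (405 + 1 + h₄ ≤ 20 * g ∧ (405 + 1 : ℝ) < h₆ ∧ (9 : ℝ) < h₅ - 405 - 1 - g ∧ (717 : ℝ) < E ∧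
        E ≤ 2 * h₄ - 1602 ∧ E ≤ A - 2 - 4 * 9 - 68 - 2 * h₅ ∧ E ≤ A - 17 - 2 * h₆) := by
  simp only [AdmissibleThresholdsK]
  norm_num

/-- Farkas certificate of regime (a2) for general `k`: multipliers `1/10, 2, 21/20, 1/20, 1` on
the rows Lemma 4.1, (4.10), (7.5), (3.4), (3.5) give `A > 26741/20 + (189/10)k`
(`k = 25`: `36191/20`; `k = 9`: `30143/20`). [folklore] -/
theorem lt_of_admissibleThresholdsK {k A E h₄ h₅ h₆ g : ℝ}
    (h : AdmissibleThresholdsK k A E h₄ h₅ h₆ g) : (26741 / 20 : ℝ) + 189 / 10 * k < A := by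
  obtain ⟨h₁, -, h₃, h₇, h₈, h₉, -⟩ := h
  linarith

/-- ALT-3's value `k = 9` in regime (a2): every admissible point has `A > 30143/20 = 1507.15`
(printed row: `36191/20 = 1809.55`). [folklore] -/
theorem lt_of_admissibleThresholdsK9 {A E h₄ h₅ h₆ g : ℝ}
    (h : AdmissibleThresholdsK 9 A E h₄ h₅ h₆ g) : (30143 / 20 : ℝ) < A := by
  have := lt_of_admissibleThresholdsK h
  linarith

/-- A witness just above the bound: `A = 1508` is admissible in regime (a2) at `k = 9`.
[folklore] -/
theorem admissibleThresholdsK9_1508 :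
    AdmissibleThresholdsK 9 1508 (859 / 2) (4063 / 4) (4861 / 10) 407 (5687 / 80) := by
  norm_num [AdmissibleThresholdsK]

/-! ### General threshold

The two floors as functions of an arbitrary lower threshold `T` for `E` (whatever step of the
manuscript turns out to bind the exceptional-set exponent: the cell's rows use (7.5)/(14.3),
`T = 717` printed, `429` under ALT-3's reading; ALT-3.md §B10 discusses further consumers). -/

/-- Regime (a), general threshold: rows (3.6) and `T < E` give `A > 1283 + T`. [folklore] -/
theorem floor_a {A E T : ℝ} (h36 : E ≤ A - 17 - 2 * 633) (hT : T < E) : 1283 + T < A := by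
  linarith

/-- Regime (a2), general threshold: rows Lemma 4.1, (4.10), `T < E`, (3.4), (3.5) with Farkas
multipliers `1/10, 2, 21/20, 1/20, 1` give `A > 21134/20 + (21/20)T` (`T = 717`: `36191/20`;
`T = 429`: `30143/20`). [folklore] -/
theorem floor_a2 {A E h₄ h₅ g T : ℝ} (h41 : 405 + 1 + h₄ ≤ 20 * g)
    (h410 : (9 : ℝ) < h₅ - 405 - 1 - g) (hT : T < E) (h34 : E ≤ 2 * h₄ - 1602)
    (h35 : E ≤ A - 2 - 4 * 9 - 68 - 2 * h₅) : (21134 / 20 : ℝ) + 21 / 20 * T < A := by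
  linarith

end Literature.NumberTheory.LFunctions.Zhang2022.ExponentLayerMV
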